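import Summits.AtomisticToContinuum.BoseEinsteinCondensation.Theses.BECHusimiAmplitudeGas
import Summits.AtomisticToContinuum.BoseEinsteinCondensation.Theorems.BECSubharmonicContinuationFreeGasCase
import HarnessLib

/-!
# Route BECHusimiAmplitudeGas — the node `PeriodicBECNonneg` (item stmt-AtomisticToContinuum-11996)
# on the sector of zero scattering length

Helper file (`--supports stmt-AtomisticToContinuum-11996`). The node (constant-mode BEC for the
NONNEGATIVE periodic near-minimisers on the thermodynamic torus, for EVERY repulsive finite-range
`v`) is the open problem. Its free instance `v = 0` is in the tree (`periodicBECNonneg_body_free`);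
here the whole **sector `scatteringLength v = 0`** is recorded as settled
(`periodicBECNonneg_zeroScatteringLength_sector`), by forgetting the sign condition in the sibling
route's proved support `FreeGasCase` of `BECSubharmonicContinuation`
(`freeGasCase_proof`: `a = 0 ⇒ E₀^per = 0` by the proved LSSY upper bound, whose `a = 0` case is
LSSY App. C `a = 0 ⇒ v(|x|) = 0` a.e., then the torus Poincaré inequality on every slice gives
`n₀ ≥ N/2` at slack `δ_N = N/(2CL_N²)`). So what the node still asks is exactly the sector
`a(v) > 0`, and a refutation must use a potential of positive scattering length.
-/

noncomputable section

namespace Summit.AtomisticToContinuum.BoseEinsteinCondensation.Theorems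

open Literature.MathematicalPhysics.QuantumManyBody.BoseGas
open _root_.Filter
open scoped ENNReal

/-- **The node on the sector of zero scattering length.** `PeriodicBECNonneg` restricted to the
admissible potentials with `scatteringLength v = 0` HOLDS: for every repulsive finite-range `v`
with `a(v) = 0` there is `ρ₀ > 0` such that for `0 < ρ < ρ₀` some `c > 0` and, for all large `N`,
some `δ > 0` make every nonnegative periodic `δ`-near-minimiser on the torus of side `(N/ρ)^{1/3}`
satisfy `condensateOccupation ≥ cN` (the item's own quantifier pattern, its hypothesis class cut
down by the one extra condition `scatteringLength v = 0`; in fact `ρ₀ = 1`, `c = 1/2` and the sign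
condition is not used: `freeGasCase_proof` of route `BECSubharmonicContinuation`).
[cite: LSSY2005, Thm. 2.2 (2.14), App. C Thm. C.1, Lemma 4.1] -/
theorem periodicBECNonneg_zeroScatteringLength_sector :
    ∀ v : ℝ → ℝ≥0∞, IsRepulsiveFiniteRange v → scatteringLength v = 0 →
      ∃ ρ₀ : ℝ, 0 < ρ₀ ∧ ∀ ρ : ℝ, 0 < ρ → ρ < ρ₀ → ∃ c : ℝ, 0 < c ∧ ∀ᶠ N : ℕ in atTop,
        ∃ δ : ℝ≥0∞, 0 < δ ∧ ∀ Ψ : PeriodicTrialState N (sideLength ρ N),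
          periodicEnergy v Ψ ≤ periodicGroundStateEnergy v N (sideLength ρ N) + δ →
            (∀ X, Ψ.ψ X = ((‖Ψ.ψ X‖ : ℝ) : ℂ)) →
            ENNReal.ofReal (c * N) ≤ condensateOccupation N (sideLength ρ N) Ψ.ψ := by
  intro v hv ha
  obtain ⟨ρ₀, hρ₀, h⟩ := freeGasCase_proof v hv ha
  refine ⟨ρ₀, hρ₀, fun ρ hρ hρlt => ?_⟩
  obtain ⟨c, hc, hN⟩ := h ρ hρ hρlt
  refine ⟨c, hc, ?_⟩
  filter_upwards [hN] with N ⟨δ, hδ, hΨ⟩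
  exact ⟨δ, hδ, fun Ψ hE _ => hΨ Ψ hE⟩

/-- **What is left of the node.** `PeriodicBECNonneg` follows from its restriction to the
potentials of POSITIVE scattering length: the sector `a(v) = 0` is
`periodicBECNonneg_zeroScatteringLength_sector`. [folklore] -/
theorem periodicBECNonneg_of_pos_sector
    (h : ∀ v : ℝ → ℝ≥0∞, IsRepulsiveFiniteRange v → 0 < scatteringLength v →
      ∃ ρ₀ : ℝ, 0 < ρ₀ ∧ ∀ ρ : ℝ, 0 < ρ → ρ < ρ₀ → ∃ c : ℝ, 0 < c ∧ ∀ᶠ N : ℕ in atTop,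
        ∃ δ : ℝ≥0∞, 0 < δ ∧ ∀ Ψ : PeriodicTrialState N (sideLength ρ N),
          periodicEnergy v Ψ ≤ periodicGroundStateEnergy v N (sideLength ρ N) + δ →
            (∀ X, Ψ.ψ X = ((‖Ψ.ψ X‖ : ℝ) : ℂ)) →
            ENNReal.ofReal (c * N) ≤ condensateOccupation N (sideLength ρ N) Ψ.ψ) :
    Summit.AtomisticToContinuum.BoseEinsteinCondensation.Theses.BECHusimiAmplitudeGas.PeriodicBECNonneg := by
  intro v hv
  rcases eq_or_ne (scatteringLength v) 0 with ha | ha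
  · exact periodicBECNonneg_zeroScatteringLength_sector v hv ha
  · exact h v hv (pos_iff_ne_zero.2 ha)

end Summit.AtomisticToContinuum.BoseEinsteinCondensation.Theorems

end
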